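import Summits.ResolutionOfSingularities.ResolutionOfSingularities.Theorems.FrobeniusLadderFRationalResolutionConeModels
import Summits.ResolutionOfSingularities.ResolutionOfSingularities.Theorems.FrobeniusLadderFRationalResolutionVeroneseSingularLocus
import Mathlib.RingTheory.FiniteType
import HarnessLib

/-!
# Crux `FrobeniusLadder.FRationalResolution` (stmt-ResolutionOfSingularities-15317), line `redirect`,
# stub `stub_diagonalizableQuotientResolution` — varieties with VERONESE-CONE singular germs are
# resolvable, in every dimension and over every field

The Veronese cone `V(n,r) = Spec k[χᵈ : |d| = r] = 𝔸ⁿ/μ_r` (weights `(1,…,1)`) is the simplest ISOLATED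
diagonalizable quotient singularity in dimension `n`, wild when `p ∣ r`; leafhand-1 and the c5 lead
landed its specimen sheet (`veroneseCone_isRegular_affineBlowup`, `veroneseCone_mem_regularLocus_iff`,
`veroneseCone_existsUnique_vertex`, `hasResolution_veroneseCone`). Feeding it to the cone-model
assembly (`…ConeModels.lean`: one-blow-up model datum + local model transfer + isolated gluing):

* `veronese_finiteType`, `veronese_locallyOfFiniteType` — `k[χᵈ : |d| = r]` is of finite type;
* `veronese_isConeModel` — `(VR[n,r], VM[n,r])` is a cone model: `VM` finitely generated, non-zero,
  with regular affine blow-up, `Reg = Spec ∖ V(VM)` and `V(VM) = {vertex}` (`n, r ≥ 2`);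
* `hasResolution_of_veroneseCone_stalks` — **an integral `X` locally of finite type over ANY field
  with finitely many singular points, each of whose local rings is `k`-isomorphic to the vertex local
  ring of some Veronese cone `V(n,r)` (`n, r ≥ 2`, depending on the point), has a resolution of
  singularities** — an all-dimensional resolved family for the stub (isolated cyclic quotient
  singularities `(1/r)(1,…,1)`), Zariski-local form.

Honest label: specimen family; the stub's general étale charts and non-isolated singular loci are
untouched. No definitions, no named facts, no sorry. [folklore; cite: Kollar2007, §2.2]
-/

noncomputable section

-- single-problem summit: the doubled namespace component is forced
set_option linter.dupNamespace false

open CategoryTheory AlgebraicGeometry TopologicalSpace MvPolynomial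
open Literature.AlgebraicGeometry.Resolution

namespace Summit.ResolutionOfSingularities.ResolutionOfSingularities.Theorems.FRationalResolution

section Cones

variable (k : Type) [Field k]

/-- The polynomial ring in `n` variables. -/
local notation3 "MP[" n "]" => MvPolynomial (Fin n) k

/-- The `r`-th Veronese subring of `k[x₁,…,xₙ]`: the `k`-subalgebra generated by the degree-`r` monomials. -/
local notation3 "VR[" n ", " r "]" =>
  Algebra.adjoin k ((fun d : Fin n →₀ ℕ => MvPolynomial.monomial d (1 : k)) ''
    {d : Fin n →₀ ℕ | Finsupp.degree d = (r : ℕ)})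

/-- The vertex ideal of the Veronese cone: spanned by the degree-`r` monomials. -/
local notation3 "VM[" n ", " r "]" =>
  Ideal.span {v : ↥VR[n, r] | ∃ d : Fin n →₀ ℕ, Finsupp.degree d = (r : ℕ) ∧
    (v : MvPolynomial (Fin n) k) = MvPolynomial.monomial d 1}

namespace VeroneseStalks

/-- The set of exponents of degree `r` in `n` variables is finite. [folklore] -/
theorem degreeSet_finite (n r : ℕ) : {d : Fin n →₀ ℕ | Finsupp.degree d = (r : ℕ)}.Finite := by
  classical
  refine (Finset.finite_toSet ((Finset.univ : Finset (Fin n)).finsuppAntidiag r)).subset fun d hd => ?_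
  rw [Finset.mem_coe, Finset.mem_finsuppAntidiag]
  refine ⟨?_, Finset.subset_univ _⟩
  rw [Set.mem_setOf_eq, Finsupp.degree_eq_sum] at hd
  exact hd

/-- **The Veronese ring `k[χᵈ : |d| = r]` is of finite type over `k`** (generated by the finitely
many degree-`r` monomials). [folklore] -/
theorem veronese_finiteType (n r : ℕ) : Algebra.FiniteType k ↥VR[n, r] := by
  classical
  have hfin : ((fun d : Fin n →₀ ℕ => MvPolynomial.monomial d (1 : k)) ''
      {d : Fin n →₀ ℕ | Finsupp.degree d = (r : ℕ)}).Finite := (degreeSet_finite n r).image _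
  rw [← Subalgebra.fg_iff_finiteType]
  exact ⟨hfin.toFinset, by rw [hfin.coe_toFinset]⟩

/-- The structure morphism `V(n,r) → Spec k` is locally of finite type. [folklore] -/
theorem veronese_locallyOfFiniteType (n r : ℕ) :
    LocallyOfFiniteType (Spec.map (CommRingCat.ofHom (algebraMap k ↥VR[n, r]))) :=
  haveI : Algebra.FiniteType k ↥VR[n, r] := veronese_finiteType k n r
  (HasRingHomProperty.Spec_iff (P := @LocallyOfFiniteType)).mpr
    (RingHom.finiteType_algebraMap.mpr inferInstance)

/-- **The Veronese cone is a cone model** (`n, r ≥ 2`): its vertex ideal `VM` is finitely generated and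
non-zero, the affine blow-up `Bl_{VM}` is regular, the regular locus is exactly the complement of
`V(VM)`, and `V(VM)` is the single vertex. [folklore; cite: Kollar2007, §2.2] -/
theorem veronese_isConeModel (n r : ℕ) (hn : 2 ≤ n) (hr : 2 ≤ r) :
    (VM[n, r]).FG ∧ VM[n, r] ≠ ⊥ ∧ Scheme.IsRegular (affineBlowup VM[n, r]) ∧
      (∀ P : Spec (CommRingCat.of ↥VR[n, r]),
        P ∈ Scheme.regularLocus (Spec (CommRingCat.of ↥VR[n, r])) ↔ ¬ VM[n, r] ≤ P.asIdeal) ∧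
      ∃ q : Spec (CommRingCat.of ↥VR[n, r]), ∀ t : Spec (CommRingCat.of ↥VR[n, r]),
        VM[n, r] ≤ t.asIdeal → t = q := by
  have hr1 : 1 ≤ r := by omega
  refine ⟨Submodule.fg_span (veroneseCone_genSet_finite k n r), ?_,
    veroneseCone_isRegular_affineBlowup k n r hr1, fun P => ?_, ?_⟩
  · -- `x₀ʳ ∈ VM` is non-zero
    have i₀ : Fin n := ⟨0, by omega⟩
    intro h0
    have hmem : (⟨(X i₀ : MP[n]) ^ r, Algebra.subset_adjoin
        ⟨Finsupp.single i₀ r, Finsupp.degree_single i₀ r, X_pow_eq_monomial.symm⟩⟩ : ↥VR[n, r]) ∈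
        VM[n, r] :=
      Ideal.subset_span ⟨Finsupp.single i₀ r, Finsupp.degree_single i₀ r, X_pow_eq_monomial⟩
    rw [h0, Ideal.mem_bot] at hmem
    have h' := congrArg Subtype.val hmem
    exact (pow_ne_zero r (X_ne_zero i₀)) h'
  · -- `Reg = Spec ∖ V(VM)`
    rw [veroneseCone_mem_regularLocus_iff k n r hn hr P, SetLike.not_le_iff_exists]
    constructor
    · rintro ⟨v, hv, hvP⟩
      exact ⟨v, Ideal.subset_span hv, hvP⟩
    · rintro ⟨v, hv, hvP⟩
      by_contra h
      push Not at h
      have hle : VM[n, r] ≤ P.asIdeal := Ideal.span_le.mpr fun w hw => h w hw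
      exact hvP (hle hv)
  · -- `V(VM) = {vertex}`
    obtain ⟨q, -, huq⟩ := veroneseCone_existsUnique_vertex k n r hr1
    exact ⟨q, fun t ht => huq t fun v hv => ht (Ideal.subset_span hv)⟩

/-- **VARIETIES WITH VERONESE-CONE SINGULAR GERMS ARE RESOLVABLE (every dimension, every field).**
Let `X` be an integral scheme locally of finite type over a field `k` with finitely many singular
points, and suppose that for every singular point `s` there are `n, r ≥ 2`, a point `q` of the
Veronese cone `V(n,r) = Spec k[χᵈ : |d| = r]` containing every degree-`r` monomial (its vertex), and a
`k`-isomorphism of germs `𝒪_{V(n,r), q} ≅ 𝒪_{X,s}`. Then `X` has a resolution of singularities.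
[folklore; cite: Kollar2007, §2.2] -/
theorem hasResolution_of_veroneseCone_stalks (X : Scheme.{0}) [IsIntegral X] (f : X ⟶ Spec (.of k))
    [LocallyOfFiniteType f] (hfin : (Scheme.regularLocus X)ᶜ.Finite)
    (hstalk : ∀ s : X, s ∉ Scheme.regularLocus X → ∃ (n r : ℕ) (_ : 2 ≤ n) (_ : 2 ≤ r)
      (q : Spec (CommRingCat.of ↥VR[n, r]))
      (_ : ∀ v : ↥VR[n, r], (∃ d : Fin n →₀ ℕ, Finsupp.degree d = r ∧
        (v : MP[n]) = MvPolynomial.monomial d 1) → v ∈ q.asIdeal)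
      (e : (Spec (CommRingCat.of ↥VR[n, r])).presheaf.stalk q ≅ X.presheaf.stalk s),
      Spec.map e.hom ≫ (Spec (CommRingCat.of ↥VR[n, r])).fromSpecStalk q ≫
        Spec.map (CommRingCat.ofHom (algebraMap k ↥VR[n, r])) = X.fromSpecStalk s ≫ f) :
    Scheme.HasResolution X := by
  refine ConeModels.hasResolution_of_cone_model_stalks k X f hfin fun s hs => ?_
  obtain ⟨n, r, hn, hr, q, hq, e, he⟩ := hstalk s hs
  obtain ⟨hfg, hI, hreg, hRegI, q', hq'⟩ := veronese_isConeModel k n r hn hr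
  haveI := veronese_locallyOfFiniteType k n r
  -- the given `q` contains `VM`, hence is the vertex `q'`
  have hqq' : q = q' := hq' q (Ideal.span_le.mpr fun v hv => hq v hv)
  subst hqq'
  exact ⟨↥VR[n, r], inferInstance, inferInstance, inferInstance, inferInstance, VM[n, r], hfg, hI,
    hreg, hRegI, q, hq', e, he⟩

end VeroneseStalks

end Cones

end Summit.ResolutionOfSingularities.ResolutionOfSingularities.Theorems.FRationalResolution

end
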